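import Mathlib.Analysis.SpecialFunctions.Pow.Real
import Mathlib.Analysis.SpecialFunctions.Sqrt
import Mathlib.Analysis.SpecificLimits.Basic
import Mathlib.Algebra.Order.Ring.Pow
import HarnessLib

/-!
# Parameter bookkeeping for Colombo–De Lellis–De Rosa 2018, Prop. 2.2 (c) (their §8.3)

Analysis/FluidPDE proofs-only file: the elementary real-variable inequalities in the second half
of the proof of Prop. 2.2 of Colombo–De Lellis–De Rosa (2018), §8.3 pp. 18–19, where the Hölder
bound (13) `‖v_e‖_{C^{α+ε}} ≤ C(α,ε) max{E₁^{2α+3ε}, E₂^{(2α+4ε)/3}}` is extracted from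
`‖v - v_0‖_{C^{α+ε}} ≤ C₀`, `‖v_0‖_{C¹} ≤ max{a^{b/(1-2α)}, a^bE₁, E₂^{(cb-1/2)/((2c-1)b-1)}}` and
`a = max{a₀(b,c), C₀E₁, C₀E₂^{1/((2c-1)b-1)}}` by letting `(ε, c, b) → (0, 5/2, 1)`:

* `exists_cdldr_c`, `exists_cdldr_b` — the choice of `c > 5/2` and of `b > 1` below a given
  `b₁ > 1` with `(α+ε)cb < 1/2` (summability of `δ_{q+1}^{1/2}λ_{q+1}^{α+ε}`, i.e.
  `ϑ < 1/(2bc)` in the proof of Thm. 2.1), `b(α+ε)/(1-2α) ≤ 2α+3ε` and `(b+1)(α+ε) ≤ 2α+3ε`;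
* `cdldr_exponents` — the seven exponent comparisons used in §8.3 (e.g.
  `(cb-1/2)/((2c-1)b-1) · (α+ε) ≤ (2α+4ε)/3`, from `(cb-1/2)/((2c-1)b-1) < 2/3` for `c > 5/2`,
  `b > 1`; the source: "`lim_{(c,b)→(5/2,1)} (cb-1/2)/((2c-1)b-1) = 2/3`");
* `rpow_neg_mul_pow_le_geom`, `summable_cdldr_geom`, `tsum_cdldr_geom_le` — the geometric
  majorants `a^{-κb^{q+1}} ≤ (a₀^{-κ(b-1)})^{q+1}` (Bernoulli) uniformly in `a ≥ a₀ > 1`, giving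
  bounds on `∑_q δ_{q+1}^{1/2}` and `∑_q δ_{q+1}^{1/2}λ_{q+1}^ϑ` independent of `E₁, E₂`;
* `cdldr_amax_rpow_le` — the final estimate
  `max{a^{b/(1-2α)}, a^bE₁, E₂^{r}}^{α+ε} ≤ Q · max{E₁^{2α+3ε}, E₂^{(2α+4ε)/3}}` with `Q`
  depending on `α, ε, b, c, a₀, C₀` only (the source's chain of displays ending in (13),
  including the Young-type step `E₂^{(α+2ε)/3}E₁^{α+ε} ≤ max{E₁^{2α+3ε}, E₂^{(2α+4ε)/3}}`).

No smallness of `ε` beyond `α + ε < 1/5` turns out to be needed.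

## References

* M. Colombo, C. De Lellis, L. De Rosa, Comm. Math. Phys. 362 (2018) (held: arXiv:1708.05666),
  §3.2 proof of Thm. 2.1 (p. 8), §8.3 (pp. 18–19). [`ColomboDelellisDerosa2018`]
-/

noncomputable section

open Filter Topology

namespace Literature.Analysis.FluidPDE

/-! ## Choice of `c` and `b` -/

/-- Choice of `c`: for `0 < ϑ < 1/5` there is `c > 5/2` with `ϑ c < 1/2` (room for
`ϑ < 1/(2bc)` with `b` near `1`). [cite: ColomboDelellisDerosa2018, §3.2, proof of Thm. 2.1] -/
theorem exists_cdldr_c {ϑ : ℝ} (hϑ : 0 < ϑ) (hϑ5 : ϑ < 1 / 5) :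
    ∃ c : ℝ, 5 / 2 < c ∧ ϑ * c < 1 / 2 := by
  refine ⟨(5 / 2 + 1 / (2 * ϑ)) / 2, ?_, ?_⟩
  · have h : 5 / 2 < 1 / (2 * ϑ) := by
      rw [lt_div_iff₀ (by positivity)]; nlinarith
    linarith
  · have h1 : ϑ * (1 / (2 * ϑ)) = 1 / 2 := by field_simp
    have h2 : ϑ * (5 / 2) < 1 / 2 := by nlinarith
    calc ϑ * ((5 / 2 + 1 / (2 * ϑ)) / 2) = (ϑ * (5 / 2) + ϑ * (1 / (2 * ϑ))) / 2 := by ring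
      _ < (1 / 2 + 1 / 2) / 2 := by rw [h1]; linarith
      _ = 1 / 2 := by norm_num

/-- Choice of `b`: given `b₁ > 1`, `0 < α < 1/5`, `ε > 0`, `α + ε < 1/5` and `c` with
`(α+ε)c < 1/2`, there is `1 < b < b₁` with `(α+ε)cb < 1/2`, `b(α+ε)/(1-2α) ≤ 2α+3ε` and
`(b+1)(α+ε) ≤ 2α+3ε` (the constraints "`b - 1` sufficiently small" of §8.3).
[cite: ColomboDelellisDerosa2018, §8.3] -/
theorem exists_cdldr_b {α ε c b₁ : ℝ} (hα : 0 < α) (hα5 : α < 1 / 5) (hε : 0 < ε)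
    (hαε : α + ε < 1 / 5) (hc : 0 < c) (hϑc : (α + ε) * c < 1 / 2) (hb₁ : 1 < b₁) :
    ∃ b : ℝ, 1 < b ∧ b < b₁ ∧ (α + ε) * c * b < 1 / 2 ∧
      b * (α + ε) / (1 - 2 * α) ≤ 2 * α + 3 * ε ∧ (b + 1) * (α + ε) ≤ 2 * α + 3 * ε := by
  have hϑ : 0 < α + ε := by linarith
  have h2α : 0 < 1 - 2 * α := by linarith
  -- the four upper constraints, each `> 1`
  set X₂ : ℝ := 1 / (2 * c * (α + ε)) with hX₂
  set X₃ : ℝ := (2 * α + 3 * ε) * (1 - 2 * α) / (α + ε) with hX₃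
  set X₄ : ℝ := (α + 2 * ε) / (α + ε) with hX₄
  have hX₂1 : 1 < X₂ := by
    rw [hX₂, lt_div_iff₀ (by positivity)]; nlinarith
  have hX₃1 : 1 < X₃ := by
    rw [hX₃, lt_div_iff₀ hϑ]; nlinarith
  have hX₄1 : 1 < X₄ := by
    rw [hX₄, lt_div_iff₀ hϑ]; linarith
  set m : ℝ := min (min b₁ X₂) (min X₃ X₄) with hm
  have hm1 : 1 < m := lt_min (lt_min hb₁ hX₂1) (lt_min hX₃1 hX₄1)
  refine ⟨(1 + m) / 2, by linarith, ?_, ?_, ?_, ?_⟩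
  · have : m ≤ b₁ := (min_le_left _ _).trans (min_le_left _ _)
    linarith
  · have hle : m ≤ X₂ := (min_le_left _ _).trans (min_le_right _ _)
    have hb : (1 + m) / 2 < X₂ := by linarith
    have : (α + ε) * c * ((1 + m) / 2) < (α + ε) * c * X₂ :=
      mul_lt_mul_of_pos_left hb (by positivity)
    have hX : (α + ε) * c * X₂ = 1 / 2 := by rw [hX₂]; field_simp
    linarith
  · have hle : m ≤ X₃ := (min_le_right _ _).trans (min_le_left _ _)
    have hb : (1 + m) / 2 ≤ X₃ := by linarith
    rw [div_le_iff₀ h2α]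
    have : (1 + m) / 2 * (α + ε) ≤ X₃ * (α + ε) := mul_le_mul_of_nonneg_right hb hϑ.le
    have hX : X₃ * (α + ε) = (2 * α + 3 * ε) * (1 - 2 * α) := by rw [hX₃]; field_simp
    linarith
  · have hle : m ≤ X₄ := (min_le_right _ _).trans (min_le_right _ _)
    have hb : (1 + m) / 2 ≤ X₄ := by linarith
    have : ((1 + m) / 2 + 1) * (α + ε) ≤ (X₄ + 1) * (α + ε) :=
      mul_le_mul_of_nonneg_right (by linarith) hϑ.le
    have hX : (X₄ + 1) * (α + ε) = 2 * α + 3 * ε := by rw [hX₄]; field_simp; ring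
    linarith

/-! ## Exponent comparisons -/

/-- The exponent comparisons of §8.3: with `ϑ = α+ε`, `p = 1/((2c-1)b-1)`, `s₀ = b/(1-2α)`,
`r = (cb-1/2)/((2c-1)b-1)` one has `pb < 1/3` and `r < 2/3` (for `c > 5/2`, `b > 1`), whence
(1) `s₀ϑ ≤ 2α+3ε`, (2) `p s₀ ϑ ≤ (2α+4ε)/3`, (3) `ϑ ≤ 2α+3ε`, (4) `bϑ + ϑ ≤ 2α+3ε`,
(5) `2pbϑ ≤ (2α+4ε)/3`, (6) `2ϑ ≤ 2α+3ε`, (7) `rϑ ≤ (2α+4ε)/3`.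
[cite: ColomboDelellisDerosa2018, §8.3 (limits of exponents, pp. 18–19)] -/
theorem cdldr_exponents {α ε b c : ℝ} (hα : 0 < α) (hα5 : α < 1 / 5) (hε : 0 < ε)
    (hαε : α + ε < 1 / 5) (hb : 1 < b) (hc : 5 / 2 < c)
    (e1 : b * (α + ε) / (1 - 2 * α) ≤ 2 * α + 3 * ε) (e3 : (b + 1) * (α + ε) ≤ 2 * α + 3 * ε) :
    0 < (2 * c - 1) * b - 1 ∧
    b / (1 - 2 * α) * (α + ε) ≤ 2 * α + 3 * ε ∧
    1 / ((2 * c - 1) * b - 1) * (b / (1 - 2 * α)) * (α + ε) ≤ (2 * α + 4 * ε) / 3 ∧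
    α + ε ≤ 2 * α + 3 * ε ∧
    b * (α + ε) + (α + ε) ≤ 2 * α + 3 * ε ∧
    2 * (1 / ((2 * c - 1) * b - 1) * b * (α + ε)) ≤ (2 * α + 4 * ε) / 3 ∧
    2 * (α + ε) ≤ 2 * α + 3 * ε ∧
    (c * b - 1 / 2) / ((2 * c - 1) * b - 1) * (α + ε) ≤ (2 * α + 4 * ε) / 3 := by
  have hϑ : 0 < α + ε := by linarith
  have h2α : 0 < 1 - 2 * α := by linarith
  have hD : 0 < (2 * c - 1) * b - 1 := by nlinarith
  -- `pb < 1/3` and `r < 2/3`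
  have hpb : 1 / ((2 * c - 1) * b - 1) * b < 1 / 3 := by
    rw [div_mul_eq_mul_div, one_mul, div_lt_div_iff₀ hD (by norm_num : (0:ℝ) < 3)]
    nlinarith
  have hr : (c * b - 1 / 2) / ((2 * c - 1) * b - 1) < 2 / 3 := by
    rw [div_lt_div_iff₀ hD (by norm_num : (0:ℝ) < 3)]
    nlinarith
  have hpb0 : 0 ≤ 1 / ((2 * c - 1) * b - 1) * b := by positivity
  have hr0 : 0 ≤ (c * b - 1 / 2) / ((2 * c - 1) * b - 1) := by
    apply div_nonneg _ hD.le; nlinarith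
  -- the key `α`-inequality: `ϑ ≤ (2α+4ε)(1-2α)`
  have hkey : (α + ε) ≤ (2 * α + 4 * ε) * (1 - 2 * α) := by nlinarith
  refine ⟨hD, ?_, ?_, by linarith, by linarith, ?_, by linarith, ?_⟩
  · rw [div_mul_eq_mul_div]; exact e1
  · -- `p s₀ ϑ = (pb) ϑ/(1-2α) ≤ ϑ/(3(1-2α)) ≤ (2α+4ε)/3`
    have h1 : 1 / ((2 * c - 1) * b - 1) * (b / (1 - 2 * α)) * (α + ε) =
        (1 / ((2 * c - 1) * b - 1) * b) * ((α + ε) / (1 - 2 * α)) := by ring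
    rw [h1]
    have h2 : (α + ε) / (1 - 2 * α) ≤ 2 * α + 4 * ε := by rwa [div_le_iff₀ h2α]
    have h3 : 0 ≤ (α + ε) / (1 - 2 * α) := by positivity
    calc (1 / ((2 * c - 1) * b - 1) * b) * ((α + ε) / (1 - 2 * α))
        ≤ (1 / 3) * (2 * α + 4 * ε) := mul_le_mul hpb.le h2 h3 (by norm_num)
      _ = (2 * α + 4 * ε) / 3 := by ring
  · calc 2 * (1 / ((2 * c - 1) * b - 1) * b * (α + ε)) = 2 * ((1 / ((2 * c - 1) * b - 1) * b) * (α + ε)) := by ring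
      _ ≤ 2 * ((1 / 3) * (α + ε)) := by gcongr
      _ ≤ (2 * α + 4 * ε) / 3 := by linarith
  · calc (c * b - 1 / 2) / ((2 * c - 1) * b - 1) * (α + ε) ≤ (2 / 3) * (α + ε) :=
          mul_le_mul_of_nonneg_right hr.le hϑ.le
      _ ≤ (2 * α + 4 * ε) / 3 := by linarith

/-! ## Geometric majorants, uniformly in `a ≥ a₀` -/

/-- Bernoulli: `(n+1)(b-1) ≤ b^{n+1}` for `b ≥ 1`. [folklore] -/
theorem succ_mul_sub_one_le_pow {b : ℝ} (hb : 1 ≤ b) (n : ℕ) : (n + 1 : ℝ) * (b - 1) ≤ b ^ (n + 1) := by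
  have h := one_add_mul_le_pow (show (-2 : ℝ) ≤ b - 1 by linarith) (n + 1)
  rw [add_sub_cancel] at h
  push_cast at h
  linarith

/-- The geometric majorant: for `1 < a₀ ≤ a`, `b > 1`, `κ > 0`,
`a^{-κ b^{n+1}} ≤ (a₀^{-κ(b-1)})^{n+1}` (antitonicity in the base, Bernoulli in the exponent).
[folklore] -/
theorem rpow_neg_mul_pow_le_geom {a₀ a b κ : ℝ} (ha₀ : 1 < a₀) (ha : a₀ ≤ a) (hb : 1 < b)
    (hκ : 0 < κ) (n : ℕ) :
    a ^ (-(κ * b ^ (n + 1))) ≤ (a₀ ^ (-(κ * (b - 1)))) ^ (n + 1) := by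
  have ha₀0 : 0 < a₀ := by linarith
  have hexp : -(κ * b ^ (n + 1)) ≤ 0 := by
    have : 0 ≤ b ^ (n + 1) := by positivity
    nlinarith
  calc a ^ (-(κ * b ^ (n + 1))) ≤ a₀ ^ (-(κ * b ^ (n + 1))) := Real.rpow_le_rpow_of_nonpos ha₀0 ha hexp
    _ ≤ a₀ ^ (-(κ * (b - 1)) * (n + 1 : ℕ)) := by
        refine Real.rpow_le_rpow_of_exponent_le ha₀.le ?_
        have h := succ_mul_sub_one_le_pow hb.le n
        push_cast
        nlinarith
    _ = (a₀ ^ (-(κ * (b - 1)))) ^ (n + 1) := by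
        rw [Real.rpow_mul ha₀0.le, Real.rpow_natCast]

/-- The ratio `ρ = a₀^{-κ(b-1)}` lies in `(0, 1)`. [folklore] -/
theorem cdldr_ratio_mem {a₀ b κ : ℝ} (ha₀ : 1 < a₀) (hb : 1 < b) (hκ : 0 < κ) :
    0 < a₀ ^ (-(κ * (b - 1))) ∧ a₀ ^ (-(κ * (b - 1))) < 1 := by
  refine ⟨Real.rpow_pos_of_pos (by linarith) _, ?_⟩
  exact Real.rpow_lt_one_of_one_lt_of_neg ha₀ (by nlinarith)

/-- Summability of the geometric majorant `C ρ^{n+1}`, `0 ≤ ρ < 1`. [folklore] -/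
theorem summable_cdldr_geom {ρ C : ℝ} (hρ0 : 0 ≤ ρ) (hρ1 : ρ < 1) :
    Summable fun n : ℕ => C * ρ ^ (n + 1) := by
  have h := (summable_geometric_of_lt_one hρ0 hρ1).mul_left (C * ρ)
  refine h.congr fun n => ?_
  rw [pow_succ]; ring

/-- The sum of the geometric majorant: `∑ C ρ^{n+1} ≤ C (1-ρ)⁻¹` for `C ≥ 0`, `0 ≤ ρ < 1`. [folklore] -/
theorem tsum_cdldr_geom_le {ρ C : ℝ} (hC : 0 ≤ C) (hρ0 : 0 ≤ ρ) (hρ1 : ρ < 1) :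
    ∑' n : ℕ, C * ρ ^ (n + 1) ≤ C * (1 - ρ)⁻¹ := by
  have hs := summable_geometric_of_lt_one hρ0 hρ1
  calc ∑' n : ℕ, C * ρ ^ (n + 1) ≤ ∑' n : ℕ, C * ρ ^ n := by
        refine Summable.tsum_le_tsum (fun n => ?_) (summable_cdldr_geom hρ0 hρ1) (hs.mul_left C)
        exact mul_le_mul_of_nonneg_left (pow_le_pow_of_le_one hρ0 hρ1.le (Nat.le_succ n)) hC
    _ = C * (1 - ρ)⁻¹ := by rw [tsum_mul_left, tsum_geometric_of_lt_one hρ0 hρ1]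

/-- A nonnegative sequence dominated by `C ρ^{n+1}` is summable with sum `≤ C(1-ρ)⁻¹`. [folklore] -/
theorem summable_and_tsum_le_of_le_geom {f : ℕ → ℝ} {ρ C : ℝ} (hC : 0 ≤ C) (hρ0 : 0 ≤ ρ)
    (hρ1 : ρ < 1) (hf0 : ∀ n, 0 ≤ f n) (hf : ∀ n, f n ≤ C * ρ ^ (n + 1)) :
    Summable f ∧ ∑' n, f n ≤ C * (1 - ρ)⁻¹ := by
  have hs : Summable f := Summable.of_nonneg_of_le hf0 hf (summable_cdldr_geom hρ0 hρ1)
  exact ⟨hs, (hs.tsum_le_tsum hf (summable_cdldr_geom hρ0 hρ1)).trans (tsum_cdldr_geom_le hC hρ0 hρ1)⟩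

/-- A sequence dominated by `ρ^{n+1}`, `0 ≤ ρ < 1`, in absolute value tends to `0`. [folklore] -/
theorem tendsto_zero_of_abs_le_geom {f : ℕ → ℝ} {ρ : ℝ} (hρ0 : 0 ≤ ρ) (hρ1 : ρ < 1)
    (hf : ∀ n, |f n| ≤ ρ ^ (n + 1)) : Tendsto f atTop (𝓝 0) := by
  have hg : Tendsto (fun n : ℕ => ρ ^ (n + 1)) atTop (𝓝 0) := by
    have := (tendsto_pow_atTop_nhds_zero_of_lt_one hρ0 hρ1).comp (tendsto_add_atTop_nat 1)
    exact this
  exact squeeze_zero_norm (fun n => by rw [Real.norm_eq_abs]; exact hf n) hg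

/-! ## The amplitude and frequency bounds of the scheme -/

/-- `√(a^{-b^q}) = a^{-(1/2) b^q}` for `a > 0`. [folklore] -/
theorem sqrt_rpow_neg_pow {a b : ℝ} (ha : 0 < a) (q : ℕ) :
    Real.sqrt (a ^ (-(b ^ q))) = a ^ (-(1 / 2 * b ^ q)) := by
  rw [Real.sqrt_eq_rpow, ← Real.rpow_mul ha.le]
  congr 1; ring

/-- The sup increments `M δ_{q+1}^{1/2} = M a^{-b^{q+1}/2}` are dominated, uniformly in `a ≥ a₀`,
by the geometric `M ρ_A^{q+1}`, `ρ_A = a₀^{-(b-1)/2}`. [cite: ColomboDelellisDerosa2018, §3 (27), (34)] -/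
theorem cdldr_increment_le_geom {a₀ a b M : ℝ} (ha₀ : 1 < a₀) (ha : a₀ ≤ a) (hb : 1 < b)
    (hM : 0 ≤ M) (q : ℕ) :
    M * Real.sqrt (a ^ (-(b ^ (q + 1)))) ≤ M * (a₀ ^ (-(1 / 2 * (b - 1)))) ^ (q + 1) := by
  have ha0 : 0 < a := by linarith
  rw [sqrt_rpow_neg_pow ha0]
  exact mul_le_mul_of_nonneg_left (rpow_neg_mul_pow_le_geom ha₀ ha hb one_half_pos q) hM

/-- The Hölder increments `2M δ_{q+1}^{1/2} Λ_{q+1}^ϑ` with `Λ_{q+1} ≤ 2a^{cb^{q+2}}` are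
dominated, uniformly in `a ≥ a₀`, by `4M ρ_K^{q+1}`, `ρ_K = a₀^{-κ(b-1)}`, `κ = 1/2 - ϑcb > 0`
(the summability `ϑ < 1/(2bc)` of the proof of Thm. 2.1:
`Mδ_{q+1}^{1/2}λ_{q+1}^ϑ ≤ C a^{b^{q+1}(2cbϑ-1)/2}`). [cite: ColomboDelellisDerosa2018, §3.2, proof of Thm. 2.1] -/
theorem cdldr_holderIncrement_le_geom {a₀ a b c ϑ M Λ : ℝ} {q : ℕ} (ha₀ : 1 < a₀) (ha : a₀ ≤ a)
    (hb : 1 < b) (hϑ0 : 0 ≤ ϑ) (hϑ1 : ϑ ≤ 1) (hκ : ϑ * c * b < 1 / 2) (hM : 0 ≤ M)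
    (hΛ0 : 0 ≤ Λ) (hΛ : Λ ≤ 2 * a ^ (c * b ^ (q + 2))) :
    2 * M * Real.sqrt (a ^ (-(b ^ (q + 1)))) * Λ ^ ϑ ≤
      4 * M * (a₀ ^ (-((1 / 2 - ϑ * c * b) * (b - 1)))) ^ (q + 1) := by
  have ha0 : 0 < a := by linarith
  have ha1 : 1 ≤ a := by linarith
  rw [sqrt_rpow_neg_pow ha0]
  -- `Λ^ϑ ≤ (2 a^{cb^{q+2}})^ϑ ≤ 2 a^{ϑ c b^{q+2}}`
  have hΛϑ : Λ ^ ϑ ≤ 2 * a ^ (ϑ * (c * b ^ (q + 2))) := by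
    calc Λ ^ ϑ ≤ (2 * a ^ (c * b ^ (q + 2))) ^ ϑ := Real.rpow_le_rpow hΛ0 hΛ hϑ0
      _ = 2 ^ ϑ * (a ^ (c * b ^ (q + 2))) ^ ϑ :=
          Real.mul_rpow (by norm_num) (Real.rpow_nonneg ha0.le _)
      _ ≤ 2 * a ^ (ϑ * (c * b ^ (q + 2))) := by
          refine mul_le_mul ?_ ?_ (Real.rpow_nonneg (Real.rpow_nonneg ha0.le _) _) (by norm_num)
          · calc (2:ℝ) ^ ϑ ≤ 2 ^ (1:ℝ) := Real.rpow_le_rpow_of_exponent_le (by norm_num) hϑ1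
              _ = 2 := Real.rpow_one 2
          · rw [← Real.rpow_mul ha0.le, mul_comm]
  -- combine the exponents: `-(1/2)b^{q+1} + ϑ c b^{q+2} = -(1/2 - ϑcb) b^{q+1}`
  have hcomb : a ^ (-(1 / 2 * b ^ (q + 1))) * a ^ (ϑ * (c * b ^ (q + 2))) =
      a ^ (-((1 / 2 - ϑ * c * b) * b ^ (q + 1))) := by
    rw [← Real.rpow_add ha0]
    congr 1; ring
  have hκ' : 0 < 1 / 2 - ϑ * c * b := by linarith
  calc 2 * M * a ^ (-(1 / 2 * b ^ (q + 1))) * Λ ^ ϑ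
      ≤ 2 * M * a ^ (-(1 / 2 * b ^ (q + 1))) * (2 * a ^ (ϑ * (c * b ^ (q + 2)))) := by
        refine mul_le_mul_of_nonneg_left hΛϑ ?_
        exact mul_nonneg (by positivity) (Real.rpow_nonneg ha0.le _)
    _ = 4 * M * (a ^ (-(1 / 2 * b ^ (q + 1))) * a ^ (ϑ * (c * b ^ (q + 2)))) := by ring
    _ = 4 * M * a ^ (-((1 / 2 - ϑ * c * b) * b ^ (q + 1))) := by rw [hcomb]
    _ ≤ 4 * M * (a₀ ^ (-((1 / 2 - ϑ * c * b) * (b - 1)))) ^ (q + 1) :=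
        mul_le_mul_of_nonneg_left (rpow_neg_mul_pow_le_geom ha₀ ha hb hκ' q) (by positivity)

/-! ## The final estimate of §8.3 -/

/-- Powers of a three-fold maximum of nonnegative reals are bounded by the sum of the powers. [folklore] -/
theorem max_three_rpow_le {x y z : ℝ} (hx : 0 ≤ x) (hy : 0 ≤ y) (hz : 0 ≤ z) (s : ℝ) :
    (max x (max y z)) ^ s ≤ x ^ s + y ^ s + z ^ s := by
  have hxs := Real.rpow_nonneg hx s
  have hys := Real.rpow_nonneg hy s
  have hzs := Real.rpow_nonneg hz s
  rcases max_choice x (max y z) with h | h <;> rw [h]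
  · linarith
  · rcases max_choice y z with h' | h' <;> rw [h'] <;> linarith

/-- Young-type step of §8.3: `P Q ≤ max{P², Q²}` for `P, Q ≥ 0`. [folklore] -/
theorem mul_le_max_sq {P Q : ℝ} (hP : 0 ≤ P) (hQ : 0 ≤ Q) : P * Q ≤ max (P ^ 2) (Q ^ 2) := by
  rcases le_total P Q with h | h
  · calc P * Q ≤ Q * Q := mul_le_mul_of_nonneg_right h hQ
      _ = Q ^ 2 := (sq Q).symm
      _ ≤ max (P ^ 2) (Q ^ 2) := le_max_right _ _
  · calc P * Q ≤ P * P := mul_le_mul_of_nonneg_left h hP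
      _ = P ^ 2 := (sq P).symm
      _ ≤ max (P ^ 2) (Q ^ 2) := le_max_left _ _

/-- Monotonicity in the exponent for bases `≥ 1`, packaged with the target maximum:
`X^s ≤ max{E₁^{u}, E₂^{w}}` when `X = E₁`, `s ≤ u` (resp. `X = E₂`, `s ≤ w`). [folklore] -/
theorem rpow_le_max_of_le_left {E₁ E₂ s u w : ℝ} (hE₁ : 1 ≤ E₁) (hs : s ≤ u) :
    E₁ ^ s ≤ max (E₁ ^ u) (E₂ ^ w) :=
  (Real.rpow_le_rpow_of_exponent_le hE₁ hs).trans (le_max_left _ _)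

/-- See `rpow_le_max_of_le_left`. [folklore] -/
theorem rpow_le_max_of_le_right {E₁ E₂ s u w : ℝ} (hE₂ : 1 ≤ E₂) (hs : s ≤ w) :
    E₂ ^ s ≤ max (E₁ ^ u) (E₂ ^ w) :=
  (Real.rpow_le_rpow_of_exponent_le hE₂ hs).trans (le_max_right _ _)

/-- **The final estimate of Colombo–De Lellis–De Rosa 2018, §8.3.** With `ϑ = α + ε`,
`p = 1/((2c-1)b-1)`, `s₀ = b/(1-2α)`, `r = (cb-1/2)/((2c-1)b-1)`, parameters as in
`cdldr_exponents`, `1 < E₁ ≤ E₂`, `C₀ ≥ 1`, `a₀ > 1` and the universal choice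
`a = max{a₀, C₀E₁, C₀E₂^p}` (81):
`max{a^{s₀}, a^bE₁, E₂^r}^ϑ ≤ Q · max{E₁^{2α+3ε}, E₂^{(2α+4ε)/3}}` with
`Q = a₀^{s₀ϑ} + 2C₀^{s₀ϑ} + a₀^{bϑ} + 2C₀^{bϑ} + 1` (independent of `E₁, E₂`). This is the chain
"`‖v‖_{C^{α+ε}} ≤ C₀ max{a^{(α+ε)b/(1-2α)}, a^{(α+ε)b}E₁^{α+ε}, E₂^{(2α+4ε)/3}} ≤ … ≤
C(α,ε) max{E₁^{2α+3ε}, E₂^{(2α+4ε)/3}}`" of the source.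
[cite: ColomboDelellisDerosa2018, §8.3 (proof of (13), pp. 18–19)] -/
theorem cdldr_amax_rpow_le {α ε b c a₀ C₀ E₁ E₂ : ℝ} (hα : 0 < α) (hα5 : α < 1 / 5) (hε : 0 < ε)
    (hαε : α + ε < 1 / 5) (hb : 1 < b) (hc : 5 / 2 < c)
    (e1 : b * (α + ε) / (1 - 2 * α) ≤ 2 * α + 3 * ε) (e3 : (b + 1) * (α + ε) ≤ 2 * α + 3 * ε)
    (ha₀ : 1 < a₀) (hC₀ : 1 ≤ C₀) (hE₁ : 1 < E₁) (hE₁₂ : E₁ ≤ E₂) :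
    (max ((max a₀ (max (C₀ * E₁) (C₀ * E₂ ^ (1 / ((2 * c - 1) * b - 1))))) ^ (b / (1 - 2 * α)))
        (max ((max a₀ (max (C₀ * E₁) (C₀ * E₂ ^ (1 / ((2 * c - 1) * b - 1))))) ^ b * E₁)
          (E₂ ^ ((c * b - 1 / 2) / ((2 * c - 1) * b - 1))))) ^ (α + ε) ≤
      (a₀ ^ (b / (1 - 2 * α) * (α + ε)) + 2 * C₀ ^ (b / (1 - 2 * α) * (α + ε)) +
          a₀ ^ (b * (α + ε)) + 2 * C₀ ^ (b * (α + ε)) + 1) *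
        max (E₁ ^ (2 * α + 3 * ε)) (E₂ ^ ((2 * α + 4 * ε) / 3)) := by
  obtain ⟨hD, x1, x2, x3, x4, x5, x6, x7⟩ := cdldr_exponents hα hα5 hε hαε hb hc e1 e3
  -- abbreviations
  set ϑ : ℝ := α + ε with hϑ_def
  set p : ℝ := 1 / ((2 * c - 1) * b - 1) with hp_def
  set s₀ : ℝ := b / (1 - 2 * α) with hs₀_def
  set r : ℝ := (c * b - 1 / 2) / ((2 * c - 1) * b - 1) with hr_def
  set a : ℝ := max a₀ (max (C₀ * E₁) (C₀ * E₂ ^ p)) with ha_def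
  set T : ℝ := max (E₁ ^ (2 * α + 3 * ε)) (E₂ ^ ((2 * α + 4 * ε) / 3)) with hT_def
  have hϑ0 : 0 ≤ ϑ := by rw [hϑ_def]; linarith
  have h2α : 0 < 1 - 2 * α := by linarith
  have hE₁1 : 1 ≤ E₁ := hE₁.le
  have hE₂1 : 1 ≤ E₂ := hE₁1.trans hE₁₂
  have hE₁0 : 0 ≤ E₁ := zero_le_one.trans hE₁1
  have hE₂0 : 0 ≤ E₂ := zero_le_one.trans hE₂1
  have hC₀0 : 0 ≤ C₀ := zero_le_one.trans hC₀
  have ha₀0 : 0 ≤ a₀ := by linarith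
  have hp0 : 0 ≤ p := by rw [hp_def]; positivity
  have hs₀0 : 0 ≤ s₀ := by rw [hs₀_def]; exact div_nonneg (by linarith) h2α.le
  have hb0 : 0 ≤ b := by linarith
  have hE₂p0 : 0 ≤ E₂ ^ p := Real.rpow_nonneg hE₂0 p
  have ha0 : 0 ≤ a := ha₀0.trans (le_max_left _ _)
  have hT1 : 1 ≤ T := (Real.one_le_rpow hE₁1 (by linarith)).trans (le_max_left _ _)
  have hT0 : 0 ≤ T := zero_le_one.trans hT1
  -- the coefficients are nonnegative
  have hq1 : 0 ≤ a₀ ^ (s₀ * ϑ) := Real.rpow_nonneg ha₀0 _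
  have hq2 : 0 ≤ C₀ ^ (s₀ * ϑ) := Real.rpow_nonneg hC₀0 _
  have hq3 : 0 ≤ a₀ ^ (b * ϑ) := Real.rpow_nonneg ha₀0 _
  have hq4 : 0 ≤ C₀ ^ (b * ϑ) := Real.rpow_nonneg hC₀0 _
  set Q : ℝ := a₀ ^ (s₀ * ϑ) + 2 * C₀ ^ (s₀ * ϑ) + a₀ ^ (b * ϑ) + 2 * C₀ ^ (b * ϑ) + 1 with hQ_def
  -- powers of `a = max{a₀, C₀E₁, C₀E₂^p}`: `a^s ≤ a₀^s + (C₀E₁)^s + (C₀E₂^p)^s`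
  have ha_pow : ∀ s : ℝ, a ^ s ≤ a₀ ^ s + (C₀ * E₁) ^ s + (C₀ * E₂ ^ p) ^ s := fun s =>
    max_three_rpow_le ha₀0 (mul_nonneg hC₀0 hE₁0) (mul_nonneg hC₀0 hE₂p0) s
  -- (i) the term `a^{s₀}`: `(a^{s₀})^ϑ = a^{s₀ϑ} ≤ (a₀^{s₀ϑ} + 2C₀^{s₀ϑ}) T`
  have hI : (a ^ s₀) ^ ϑ ≤ (a₀ ^ (s₀ * ϑ) + 2 * C₀ ^ (s₀ * ϑ)) * T := by
    rw [← Real.rpow_mul ha0]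
    refine (ha_pow (s₀ * ϑ)).trans ?_
    have t1 : a₀ ^ (s₀ * ϑ) ≤ a₀ ^ (s₀ * ϑ) * T := le_mul_of_one_le_right hq1 hT1
    have t2 : (C₀ * E₁) ^ (s₀ * ϑ) ≤ C₀ ^ (s₀ * ϑ) * T := by
      rw [Real.mul_rpow hC₀0 hE₁0]
      exact mul_le_mul_of_nonneg_left (rpow_le_max_of_le_left hE₁1 x1) hq2
    have t3 : (C₀ * E₂ ^ p) ^ (s₀ * ϑ) ≤ C₀ ^ (s₀ * ϑ) * T := by
      rw [Real.mul_rpow hC₀0 hE₂p0, ← Real.rpow_mul hE₂0]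
      refine mul_le_mul_of_nonneg_left (rpow_le_max_of_le_right hE₂1 ?_) hq2
      calc p * (s₀ * ϑ) = p * s₀ * ϑ := by ring
        _ ≤ (2 * α + 4 * ε) / 3 := x2
    linarith
  -- (ii) the term `a^b E₁`: `(a^b E₁)^ϑ = a^{bϑ} E₁^ϑ ≤ (a₀^{bϑ} + 2C₀^{bϑ}) T`
  have hII : (a ^ b * E₁) ^ ϑ ≤ (a₀ ^ (b * ϑ) + 2 * C₀ ^ (b * ϑ)) * T := by
    rw [Real.mul_rpow (Real.rpow_nonneg ha0 b) hE₁0, ← Real.rpow_mul ha0]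
    have hE₁ϑ : 0 ≤ E₁ ^ ϑ := Real.rpow_nonneg hE₁0 ϑ
    calc a ^ (b * ϑ) * E₁ ^ ϑ ≤ (a₀ ^ (b * ϑ) + (C₀ * E₁) ^ (b * ϑ) + (C₀ * E₂ ^ p) ^ (b * ϑ)) * E₁ ^ ϑ :=
          mul_le_mul_of_nonneg_right (ha_pow (b * ϑ)) hE₁ϑ
      _ = a₀ ^ (b * ϑ) * E₁ ^ ϑ + C₀ ^ (b * ϑ) * (E₁ ^ (b * ϑ) * E₁ ^ ϑ) +
            C₀ ^ (b * ϑ) * (E₂ ^ (p * (b * ϑ)) * E₁ ^ ϑ) := by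
          rw [Real.mul_rpow hC₀0 hE₁0, Real.mul_rpow hC₀0 hE₂p0, ← Real.rpow_mul hE₂0]; ring
      _ ≤ a₀ ^ (b * ϑ) * T + C₀ ^ (b * ϑ) * T + C₀ ^ (b * ϑ) * T := by
          refine add_le_add (add_le_add ?_ ?_) ?_
          · exact mul_le_mul_of_nonneg_left (rpow_le_max_of_le_left hE₁1 x3) hq3
          · refine mul_le_mul_of_nonneg_left ?_ hq4
            rw [← Real.rpow_add (by linarith : (0:ℝ) < E₁)]
            exact rpow_le_max_of_le_left hE₁1 x4
          · refine mul_le_mul_of_nonneg_left ?_ hq4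
            -- Young-type step: `E₂^{pbϑ} E₁^ϑ ≤ max{E₂^{2pbϑ}, E₁^{2ϑ}} ≤ T`
            have hP : 0 ≤ E₂ ^ (p * (b * ϑ)) := Real.rpow_nonneg hE₂0 _
            refine (mul_le_max_sq hP hE₁ϑ).trans (max_le ?_ ?_)
            · have e : (E₂ ^ (p * (b * ϑ))) ^ 2 = E₂ ^ (2 * (p * b * ϑ)) := by
                rw [← Real.rpow_natCast, ← Real.rpow_mul hE₂0]; congr 1; push_cast; ring
              rw [e]
              exact rpow_le_max_of_le_right hE₂1 (by
                calc 2 * (p * b * ϑ) = 2 * (1 / ((2 * c - 1) * b - 1) * b * (α + ε)) := by rw [hp_def]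
                  _ ≤ (2 * α + 4 * ε) / 3 := x5)
            · have e : (E₁ ^ ϑ) ^ 2 = E₁ ^ (2 * ϑ) := by
                rw [← Real.rpow_natCast, ← Real.rpow_mul hE₁0]; congr 1; push_cast; ring
              rw [e]
              exact rpow_le_max_of_le_left hE₁1 x6
      _ = (a₀ ^ (b * ϑ) + 2 * C₀ ^ (b * ϑ)) * T := by ring
  -- (iii) the term `E₂^r`: `(E₂^r)^ϑ = E₂^{rϑ} ≤ T`
  have hIII : (E₂ ^ r) ^ ϑ ≤ 1 * T := by
    rw [← Real.rpow_mul hE₂0, one_mul]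
    exact rpow_le_max_of_le_right hE₂1 x7
  -- combine through the three-fold maximum
  have hmax := max_three_rpow_le (Real.rpow_nonneg ha0 s₀) (mul_nonneg (Real.rpow_nonneg ha0 b) hE₁0)
    (Real.rpow_nonneg hE₂0 r) ϑ
  refine hmax.trans ?_
  calc (a ^ s₀) ^ ϑ + (a ^ b * E₁) ^ ϑ + (E₂ ^ r) ^ ϑ
      ≤ (a₀ ^ (s₀ * ϑ) + 2 * C₀ ^ (s₀ * ϑ)) * T + (a₀ ^ (b * ϑ) + 2 * C₀ ^ (b * ϑ)) * T + 1 * T :=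
        add_le_add (add_le_add hI hII) hIII
    _ = Q * T := by rw [hQ_def]; ring

end Literature.Analysis.FluidPDE
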